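import Mathlib
import Literature.Computability.Complexity.LowDegreeZeroTest
import HarnessLib

/-!
# `PairwiseCurvedTilingsLC` (crux stmt-MatrixMultiplication-17883), line `LonelyTranslates`:
Schwartz–Zippel counting of the `A − C` shadow on a box hypersurface

Finite-field endgame (stub E) of the conditional refutation of `PairwiseCurvedTilingsLC`
(skeleton `Cruxes/PairwiseCurvedTilingsLC/Lines/LonelyTranslates.lean`).  For a family
`(A_x, B_x, C_x)_{x ∈ I}` of finite subsets of `F^m` (`F` a finite field) satisfying the pattern
`i = j` of the CKSU simultaneous-triple-product-property clause, with all `B_x ≠ ∅`: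

* the `A − C` shadow `⋃_{x ∈ I} (A_x − C_x)` is a PACKING: the map `(x, a, c) ↦ a − c` is
  injective, so the shadow has exactly `Σ_x |A_x||C_x|` points (`t = t'` instances of the
  pattern; private `shadow_card_eq_sum`, adapted from ideator k1's `card_acShadow`);
* if moreover the shadow lies on the zero set of a NON-ZERO box polynomial
  `P = Σ_{β ∈ {0,…,N}^m} d_β ∏_l W_l^{β_l}` (so `deg P ≤ mN`), then Schwartz–Zippel in counting
  form (`Literature…LowDegreeExtension.card_eval_eq_zero_mul_le`: `#Z(P)·|F| ≤ deg P·|F|^m`)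
  gives the bound of `stub_shadow_card_le`:  `Σ_x |A_x||C_x| ≤ mN·|F|^{m−1}` (real form, exponent
  `Real.rpow _ ((m:ℝ) − 1)`, valid also for `m = 0`).

In the line this is applied to the big-`B` blocks of a definable pairwise-STPP family, the box
polynomial coming (by transfer from pseudo-finite fields) from the hypersurface off which the
shadow is étale-open; it yields `PorosityShadowBound`, whence `¬ PairwiseCurvedTilingsLC` by k1's
`notLC_of_shadowBound`.  Elementary, sorry-free, def-free.
-/

set_option linter.dupNamespace false  -- `Summit.<S>.<S>.…` is the mandated namespace

namespace Summit.MatrixMultiplication.MatrixMultiplication.Theorems.PairwiseCurvedTilingsLC.Negative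

open Finset

/-! ## The packing of the `A − C` shadow (pattern `i = j`, `t = t'`) -/

/-- Packing of the `A − C` shadow under pattern `i = j` (all `B_k ≠ ∅`): the blocks `A_k − C_k`
are pairwise disjoint and `(a, c) ↦ a − c` is injective on each `A_k × C_k`, so
`|⋃_k (A_k − C_k)| = Σ_k |A_k||C_k|`. -/
private theorem shadow_card_eq_sum {H : Type*} [AddCommGroup H] [DecidableEq H] {ι : Type*}
    {I : Finset ι} {A B C : ι → Finset H}
    (h : ∀ i ∈ I, ∀ k ∈ I, ∀ s ∈ A k, ∀ s' ∈ A i, ∀ t ∈ B i, ∀ t' ∈ B i, ∀ u ∈ C i, ∀ u' ∈ C k,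
      (s' - s) + (t' - t) + (u' - u) = 0 → i = k ∧ s = s' ∧ t = t' ∧ u = u')
    (hB : ∀ k ∈ I, (B k).Nonempty) :
    (I.biUnion fun k => image₂ (· - ·) (A k) (C k)).card = ∑ k ∈ I, (A k).card * (C k).card := by
  -- adapted from `card_acShadow`, Cruxes/PairwiseCurvedTilingsLC/LonelyTranslates.lean (ideator k1)
  rw [card_biUnion]
  · refine sum_congr rfl fun k hk => ?_
    rw [card_image₂_iff.2]
    intro ⟨a, c⟩ hac ⟨a', c'⟩ hac' heq
    simp only [Set.mem_prod, mem_coe] at hac hac'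
    obtain ⟨t, ht⟩ := hB k hk
    have h0 : (a' - a) + (t - t) + (c - c') = 0 := by
      have : (a' - a) + (t - t) + (c - c') = (a' - c') - (a - c) := by abel
      rw [this]; exact sub_eq_zero.2 heq.symm
    obtain ⟨-, haa, -, hcc⟩ := h k hk k hk a hac.1 a' hac'.1 t ht t ht c' hac'.2 c hac.2 h0
    exact Prod.ext haa hcc.symm
  · intro k hk l hl hkl
    rw [Function.onFun, disjoint_left]
    intro v hvk hvl
    simp only [mem_image₂] at hvk hvl
    obtain ⟨a, ha, c, hc, rfl⟩ := hvk
    obtain ⟨a', ha', c', hc', he⟩ := hvl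
    obtain ⟨t, ht⟩ := hB k hk
    have h0 : (a - a') + (t - t) + (c' - c) = 0 := by
      have : (a - a') + (t - t) + (c' - c) = (a - c) - (a' - c') := by abel
      rw [this, he, sub_self]
    exact hkl (h k hk l hl a' ha' a ha t ht t ht c hc c' hc' h0).1

/-! ## The box polynomial `Σ_β d_β ∏_l W_l^{β_l}`: evaluation, non-vanishing, degree -/

/-- The box sum `Σ_β d_β ∏_l w_l^{β_l}` is the evaluation at `w` of the box polynomial
`Σ_β d_β · W^β`. -/
private theorem boxSum_eq_eval_boxPoly {K : Type} [Field K] {m N : ℕ}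
    (d : (Fin m → Fin (N + 1)) → K) (w : Fin m → K) :
    ∑ β : Fin m → Fin (N + 1), d β * ∏ l : Fin m, w l ^ ((β l : ℕ)) =
      MvPolynomial.eval w (∑ β : Fin m → Fin (N + 1),
        MvPolynomial.monomial (Finsupp.equivFunOnFinite.symm fun l => ((β l : ℕ))) (d β)) := by
  -- adapted from the lead's skeleton (`boxSum_eq_eval`)
  rw [map_sum]
  refine Finset.sum_congr rfl fun β _ => ?_
  rw [MvPolynomial.eval_monomial]
  congr 1
  rw [Finsupp.prod_fintype]
  · rfl
  · intro i; rw [pow_zero]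

/-- The box polynomial of a non-zero coefficient function is non-zero: the exponent map
`β ↦ (l ↦ β_l)` is injective on the box, so the coefficient of `W^β` is `d_β`. -/
private theorem boxPoly_ne_zero {K : Type} [Field K] {m N : ℕ}
    {d : (Fin m → Fin (N + 1)) → K} (hd : d ≠ 0) :
    (∑ β : Fin m → Fin (N + 1),
        MvPolynomial.monomial (Finsupp.equivFunOnFinite.symm fun l => ((β l : ℕ))) (d β)) ≠ 0 := by
  classical
  obtain ⟨β₀, hβ₀⟩ := Function.ne_iff.1 hd
  intro h0
  apply hβ₀
  have hc := congrArg
    (MvPolynomial.coeff (Finsupp.equivFunOnFinite.symm fun l => ((β₀ l : ℕ)))) h0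
  rw [MvPolynomial.coeff_sum, MvPolynomial.coeff_zero, Finset.sum_eq_single β₀] at hc
  · rwa [MvPolynomial.coeff_monomial, if_pos rfl] at hc
  · intro β _ hne
    rw [MvPolynomial.coeff_monomial, if_neg]
    intro heq
    apply hne
    funext l
    have hl := congrArg (fun f : Fin m →₀ ℕ => f l) heq
    simp only [Finsupp.coe_equivFunOnFinite_symm] at hl
    exact Fin.ext hl
  · intro hβ; exact absurd (Finset.mem_univ _) hβ

/-- The box polynomial with exponents `≤ N` in each of the `m` variables has total degree
`≤ m N`. -/
private theorem totalDegree_boxPoly_le {K : Type} [Field K] {m N : ℕ}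
    (d : (Fin m → Fin (N + 1)) → K) :
    (∑ β : Fin m → Fin (N + 1),
        MvPolynomial.monomial (Finsupp.equivFunOnFinite.symm fun l => ((β l : ℕ))) (d β)).totalDegree
      ≤ m * N := by
  refine MvPolynomial.totalDegree_finsetSum_le fun β _ => ?_
  refine (MvPolynomial.totalDegree_monomial_le _ _).trans ?_
  rw [Finsupp.sum_fintype _ _ (fun _ => rfl)]
  calc ∑ l : Fin m, id ((Finsupp.equivFunOnFinite.symm fun l => ((β l : ℕ))) l)
      ≤ ∑ _l : Fin m, N := Finset.sum_le_sum fun l _ => by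
          rw [Finsupp.coe_equivFunOnFinite_symm]; exact Nat.lt_succ_iff.1 (β l).2
    _ = m * N := by rw [Finset.sum_const, Finset.card_univ, Fintype.card_fin, smul_eq_mul]

/-! ## Stub E: the counting bound -/

/-- **Shadow counting** (stub E of line `LonelyTranslates`): under pattern `i = j`, the `A − C`
shadow is a packing of size `Σ |A_x||C_x|` (all `B_x ≠ ∅`); if it lies on the zero set of a
NON-ZERO box polynomial `Σ_β d_β ∏_l W_l^{β_l}` (exponents `≤ N`, so total degree `≤ mN`) then, by
Schwartz–Zippel, `Σ |A_x||C_x| ≤ mN·|F|^{m−1}`. -/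
theorem stub_shadow_card_le {F : Type} [Field F] [Fintype F] [DecidableEq F] {e m N : ℕ}
    (I : Finset (Fin e → F)) (A B C : (Fin e → F) → Finset (Fin m → F))
    (hpat : ∀ i ∈ I, ∀ k ∈ I, ∀ s ∈ A k, ∀ s' ∈ A i, ∀ t ∈ B i, ∀ t' ∈ B i, ∀ u ∈ C i,
      ∀ u' ∈ C k, (s' - s) + (t' - t) + (u' - u) = 0 → i = k ∧ s = s' ∧ t = t' ∧ u = u')
    (hB : ∀ x ∈ I, (B x).Nonempty)
    (d : (Fin m → Fin (N + 1)) → F) (hd : d ≠ 0)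
    (hvan : ∀ x ∈ I, ∀ a ∈ A x, ∀ u ∈ C x,
      ∑ β : Fin m → Fin (N + 1), d β * ∏ l : Fin m, (a - u) l ^ ((β l : ℕ)) = 0) :
    ((∑ x ∈ I, (A x).card * (C x).card : ℕ) : ℝ) ≤
      ((m * N : ℕ) : ℝ) * (Fintype.card F : ℝ) ^ ((m : ℝ) - 1) := by
  -- the box polynomial and its zero set
  set P : MvPolynomial (Fin m) F := ∑ β : Fin m → Fin (N + 1),
    MvPolynomial.monomial (Finsupp.equivFunOnFinite.symm fun l => ((β l : ℕ))) (d β) with hP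
  have hP0 : P ≠ 0 := boxPoly_ne_zero hd
  have hdeg : P.totalDegree ≤ m * N := totalDegree_boxPoly_le d
  -- the shadow lies in the zero set of `P`
  have hsub : (I.biUnion fun k => image₂ (· - ·) (A k) (C k)) ⊆
      univ.filter fun w : Fin m → F => MvPolynomial.eval w P = 0 := by
    intro w hw
    simp only [mem_biUnion, mem_image₂] at hw
    obtain ⟨x, hx, a, ha, u, hu, rfl⟩ := hw
    rw [mem_filter, hP, ← boxSum_eq_eval_boxPoly]
    exact ⟨mem_univ _, hvan x hx a ha u hu⟩
  -- Schwartz–Zippel, counting form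
  have hnat : (∑ x ∈ I, (A x).card * (C x).card) * Fintype.card F ≤
      m * N * Fintype.card F ^ m := by
    rw [← shadow_card_eq_sum hpat hB]
    calc (I.biUnion fun k => image₂ (· - ·) (A k) (C k)).card * Fintype.card F
        ≤ (univ.filter fun w : Fin m → F => MvPolynomial.eval w P = 0).card * Fintype.card F :=
          Nat.mul_le_mul_right _ (card_le_card hsub)
      _ ≤ P.totalDegree * Fintype.card F ^ m :=
          Literature.Computability.Complexity.LowDegreeExtension.card_eval_eq_zero_mul_le hP0
      _ ≤ m * N * Fintype.card F ^ m := Nat.mul_le_mul_right _ hdeg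
  -- real-number form: divide by `|F| > 0`
  have hq : (0 : ℝ) < (Fintype.card F : ℝ) := by exact_mod_cast Fintype.card_pos
  rw [Real.rpow_sub_one hq.ne', Real.rpow_natCast, ← mul_div_assoc, le_div_iff₀ hq]
  exact_mod_cast hnat

end Summit.MatrixMultiplication.MatrixMultiplication.Theorems.PairwiseCurvedTilingsLC.Negative
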